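import Literature.AlgebraicGeometry.GroupSchemes.EtaleSchemeHomOfPoints      -- ★ p851153 `hom_ext_of_points`, `exists_hom_specOver_comp_eq`
import Literature.AlgebraicGeometry.GroupSchemes.HopfIdealClosedSubgroup      -- ★ `quotIncl`, `exists_comp_quotIncl_eq_of_le_ker`
import HarnessLib

/-!
# Morphisms out of a finite étale group scheme over `k = k̄` THROUGH A PRESCRIBED MORPHISM `Spec H → Y` (e.g. a closed subscheme
# `Spec (Γ(G″) ⧸ J) ↪ G″ → Y`), built from a factorisation on points ([Tate1997FiniteFlatGroupSchemes] (3.7); [StacksProject] Tag 00U3)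

Topic `Literature/AlgebraicGeometry/GroupSchemes`; namespace `Literature.AlgebraicGeometry.GroupSchemes.EtaleHomOfPoints` (sequel of ★
`EtaleSchemeHomOfPoints`).  THEOREMS ONLY (no definition, no instance, no notation, no named fact, no `sorry`).
Cell `hodgecm-mathlib` (D-0151), programme P6 «MOD» (crux hLiu418 = stmt-HodgeConjecture-24832, `--supports`, count-neutral): the generic floor
of the (IMG) row's organ (U1) `exists_layerΩ_hom_of_imgLine` (line L2, A-p06 (g37)) — the upstairs image factorisation of the reduced roof legs
through the closed subscheme of a line AS A MORPHISM.  HC_CM is proved only modulo the printed citations until rung 0 closes; this file is generic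
and changes no count.

THE PRINT.  [Tate1997FiniteFlatGroupSchemes] (3.7): over an algebraically closed field a finite étale group scheme `G` «is» the constant group
scheme on its points, so a morphism `G → Spec H` over `k` is the same thing as a function from `G(k)` to `(Spec H)(k)` (★ `exists_hom_specOver_comp_eq`)
and two morphisms `G → Y` agreeing on `k`-points are equal (★ `hom_ext_of_points`); [StacksProject] Tag 00U3 (`Hom(Spec (k^I), Spec H) = Hom_k(H, k)^I`).
Consequently: if `f : G → Y` factors on `k`-POINTS through a morphism `g : Spec H → Y` (for every `k`-point `x` of `G` some `k`-point `z` of `Spec H` has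
`g(z) = f(x)`), then `f` FACTORS through `g` as a morphism; in particular through a closed subscheme `Spec (Γ(G″) ⧸ J) ↪ G″ —g→ Y` of an affine
`k`-scheme `G″` as soon as every `f(x)` is `g(x″)` for a `k`-point `x″` of `G″` killing `J` ([GortzWedhorn2023] §(27.2) p. 607: points of `V(J)` = points
whose algebra map kills `J`, ★ `exists_comp_quotIncl_eq_of_le_ker`).

## Contents
* §1 **`exists_hom_comp_eq_of_points`** — `f : G ⟶ Y` factors through `g : specOver k H ⟶ Y` as soon as it does on `k`-points; `existsUnique_…` when `g` is a monomorphism.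
* §2 **`exists_hom_comp_quotIncl_comp_eq_of_points`** — the same through `quotIncl G″ J ≫ g` for an affine `G″` and an ideal `J ⊆ Γ(G″)`, the points
  hypothesis in the `ptEquiv`-kills-`J` currency of ★ `HopfIdealClosedSubgroup` §3.

## References
* [Tate1997FiniteFlatGroupSchemes] J. Tate, *Finite flat group schemes*, in: Modular Forms and Fermat's Last Theorem (1997), (3.7).
* [StacksProject] The Stacks Project, Tag 00U3.
* [GortzWedhorn2023] U. Görtz, T. Wedhorn, *Algebraic Geometry II* (2023), (27.1.1) and §(27.2) (pp. 606–607).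
-/

set_option autoImplicit false

-- Mathlib's `Over`/`Scheme` APIs are stated across semireducible wrappers (as in the ★ `GroupSchemes/*` files).
set_option backward.isDefEq.respectTransparency false

universe u

open CategoryTheory CategoryTheory.Limits AlgebraicGeometry MonoidalCategory CartesianMonoidalCategory
open scoped MonObj

noncomputable section

namespace Literature.AlgebraicGeometry.GroupSchemes

namespace EtaleHomOfPoints

open AffineGroupScheme
open Literature.AlgebraicGeometry.Motives (SchemeOver specOver AlgPoints)

variable {k : Type u} [Field k] (G : Over (Spec (.of k))) [GrpObj G]

/-! ## §1 A morphism out of a finite étale group scheme factors through `Spec H → Y` as soon as it does on points -/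

/-- **FACTORISATION THROUGH `g : Spec H → Y` FROM A FACTORISATION ON POINTS.**  For `G` a finite étale group scheme over `k = k̄`, `H` any `k`-algebra,
`g : Spec H ⟶ Y` and `f : G ⟶ Y` over `k`: if for every `k`-point `x` of `G` there is a `k`-point `z` of `Spec H` with `z ≫ g = x ≫ f`, then `f = m ≫ g`
for some `m : G ⟶ Spec H` over `k` — choose `z = Φ x`, build `m` with `x ≫ m = Φ x` (★ `exists_hom_specOver_comp_eq`), and compare `m ≫ g` with `f` on
points (★ `hom_ext_of_points`). [cite: Tate1997FiniteFlatGroupSchemes, (3.7)] [cite: StacksProject, Tag 00U3] -/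
theorem exists_hom_comp_eq_of_points [IsAlgClosed k] [IsFinite G.hom] [Etale G.hom] (H : Type u) [CommRing H] [Algebra k H]
    {Y : Over (Spec (.of k))} (g : specOver k H ⟶ Y) (f : G ⟶ Y)
    (h : ∀ x : specOver k k ⟶ G, ∃ z : specOver k k ⟶ specOver k H, z ≫ g = x ≫ f) :
    ∃ m : G ⟶ specOver k H, m ≫ g = f := by
  classical
  choose Φ hΦ using h
  obtain ⟨m, hm⟩ := exists_hom_specOver_comp_eq G H Φ
  refine ⟨m, hom_ext_of_points G (m ≫ g) f fun x => ?_⟩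
  rw [← Category.assoc, hm x, hΦ x]

/-- **… UNIQUELY when `g` is a monomorphism** (e.g. a closed immersion). [cite: Tate1997FiniteFlatGroupSchemes, (3.7)] -/
theorem existsUnique_hom_comp_eq_of_points [IsAlgClosed k] [IsFinite G.hom] [Etale G.hom] (H : Type u) [CommRing H] [Algebra k H]
    {Y : Over (Spec (.of k))} (g : specOver k H ⟶ Y) [Mono g] (f : G ⟶ Y)
    (h : ∀ x : specOver k k ⟶ G, ∃ z : specOver k k ⟶ specOver k H, z ≫ g = x ≫ f) :
    ∃! m : G ⟶ specOver k H, m ≫ g = f := by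
  obtain ⟨m, hm⟩ := exists_hom_comp_eq_of_points G H g f h
  exact ⟨m, hm, fun m' hm' => (cancel_mono g).1 (hm'.trans hm.symm)⟩

/-! ## §2 … through a closed subscheme `Spec (Γ(G″) ⧸ J) ↪ G″ → Y` of an affine `k`-scheme -/

/-- **FACTORISATION THROUGH THE CLOSED SUBSCHEME `V(J) = Spec (Γ(G″) ⧸ J) ↪ G″` OVER A LEG `g : G″ → Y`, FROM POINTS.**  For `G` a finite étale group scheme
over `k = k̄`, `G″` an affine `k`-scheme with an ideal `J ⊆ Γ(G″)`, and `k`-morphisms `g : G″ ⟶ Y`, `f : G ⟶ Y`: if every `k`-point `x` of `G` has a partner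
`k`-point `x″` of `G″` whose algebra map kills `J` and with `x″ ≫ g = x ≫ f`, then there is `m : G ⟶ V(J)` with `m ≫ (V(J) ↪ G″) ≫ g = f` (the partner factors
through `V(J)` by ★ `exists_comp_quotIncl_eq_of_le_ker`; then §1).  The morphism-level form of «`f(G) ⊆ g(V(J))` on points».
[cite: Tate1997FiniteFlatGroupSchemes, (3.7)] [cite: GortzWedhorn2023, (27.1.1) and §(27.2) (p. 607)] -/
theorem exists_hom_comp_quotIncl_comp_eq_of_points [IsAlgClosed k] [IsFinite G.hom] [Etale G.hom]
    (G'' : SchemeOver k) [IsAffine G''.left] (J : Ideal (Alg G'')) {Y : Over (Spec (.of k))} (g : G'' ⟶ Y) (f : G ⟶ Y)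
    (h : ∀ x : specOver k k ⟶ G, ∃ x'' : specOver k k ⟶ G'',
      J ≤ RingHom.ker (ptEquiv G'' k x'').toRingHom ∧ x'' ≫ g = x ≫ f) :
    ∃ m : G ⟶ specOver k (Alg G'' ⧸ J), m ≫ quotIncl G'' J ≫ g = f := by
  refine exists_hom_comp_eq_of_points G (Alg G'' ⧸ J) (quotIncl G'' J ≫ g) f fun x => ?_
  obtain ⟨x'', hJ, hx''⟩ := h x
  obtain ⟨z, hz⟩ := exists_comp_quotIncl_eq_of_le_ker G'' J x'' hJ
  exact ⟨z, by rw [← Category.assoc, hz, hx'']⟩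

/-- The same with the points hypothesis phrased directly on `V(J)`: every `x ≫ f` is `z ≫ (V(J) ↪ G″) ≫ g` for a `k`-point `z` of `V(J)`.
[cite: Tate1997FiniteFlatGroupSchemes, (3.7)] [cite: GortzWedhorn2023, §(27.2) (p. 607)] -/
theorem exists_hom_comp_quotIncl_comp_eq_of_points' [IsAlgClosed k] [IsFinite G.hom] [Etale G.hom]
    (G'' : SchemeOver k) [IsAffine G''.left] (J : Ideal (Alg G'')) {Y : Over (Spec (.of k))} (g : G'' ⟶ Y) (f : G ⟶ Y)
    (h : ∀ x : specOver k k ⟶ G, ∃ z : specOver k k ⟶ specOver k (Alg G'' ⧸ J), z ≫ quotIncl G'' J ≫ g = x ≫ f) :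
    ∃ m : G ⟶ specOver k (Alg G'' ⧸ J), m ≫ quotIncl G'' J ≫ g = f :=
  exists_hom_comp_eq_of_points G (Alg G'' ⧸ J) (quotIncl G'' J ≫ g) f h

end EtaleHomOfPoints

end Literature.AlgebraicGeometry.GroupSchemes

end
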